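import Summits.AtomisticToContinuum.HydrodynamicLimit.Theorems.RelayRaceLocalityNearConstantShortTimeHLTorusCells
import Summits.AtomisticToContinuum.HydrodynamicLimit.Theorems.SuperextensiveClosureCostBlockEntropyBudgetBallAverages
import HarnessLib

/-!
# Crux `NearConstantShortTimeHL` (stmt-AtomisticToContinuum-12502), line `small-tilt-domination` — cells meeting a ball

Support file for the crux `…Theses.RelayRaceLocality.NearConstantShortTimeHL`, line
`small-tilt-domination`, registered stub `cells_meeting_ball_card_le` (lead c7, wave 1).

The flat torus `𝕋³ = UnitAddTorus (Fin 3)` is cut into the `k³` half-open cells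
`cell j = {y | gridIndex k (repr y) = finIndex j}`, `j : Fin 3 → Fin k`, of side `1/k` (file
`…NearConstantShortTimeHLTorusCells`), and each cell `j` carries a marked point `c j ∈ cell j`.

* `cmb_euclidDist_le_of_cell` — two points of one cell are at minimal-image distance `≤ √3/k`
  (their fundamental-cube representatives lie in one grid cell `Q_k(j)` of `ℝ³`, of Euclidean
  diameter `√3/k`, and `d_𝕋³(proj a, proj b) ≤ ‖a - b‖`).
* `cells_meeting_ball_card_le` — **volume count of the cells whose marked point is `ℓ`-close to a
  point `x`**: there are at most `k³ · (4/3)π(ℓ + 2/k)³` of them, provided `ℓ + 2/k < 1/2`. Indeed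
  every such cell lies inside the minimal-image ball `B(x, ℓ + 2/k)` (triangle inequality,
  `√3/k < 2/k`); the cells are pairwise disjoint of Haar volume `k⁻³` each, and the ball, having
  radius `< 1/2`, has the Euclidean volume `(4/3)π(ℓ + 2/k)³`.

References: folklore (elementary volume packing on the flat torus).
-/

noncomputable section

namespace Summit.AtomisticToContinuum.HydrodynamicLimit.Theorems.NearConstantShortTimeHL

open scoped BigOperators ENNReal
open MeasureTheory Set Filter Topology
open Literature.MathematicalPhysics.KineticTheory Literature.Analysis.FluidPDE Literature.Analysis.FunctionSpaces

/-- **Cells have minimal-image diameter `≤ √3/k`.** Two points of the cell of index `j` are at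
minimal-image distance at most `√3/k`: their representatives lie in the grid cell `Q_k(j)` of `ℝ³`
(`Torus.norm_sub_le_of_mem_gridCell`) and `d_𝕋³(proj a, proj b) ≤ ‖a - b‖`
(`Torus.euclidDist_proj_le_norm_sub_holds`, `Torus.proj_repr`). [folklore] -/
theorem cmb_euclidDist_le_of_cell {k : ℕ} (hk : 0 < k) {j : Fin 3 → Fin k} {y z : T3}
    (hy : Torus.gridIndex k (Torus.repr y) = Torus.finIndex j)
    (hz : Torus.gridIndex k (Torus.repr z) = Torus.finIndex j) :
    Torus.euclidDist y z ≤ Real.sqrt 3 / k := by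
  have h := Torus.norm_sub_le_of_mem_gridCell hk ((Torus.mem_gridCell_iff_gridIndex_eq hk).2 hy)
    ((Torus.mem_gridCell_iff_gridIndex_eq hk).2 hz)
  rw [Fintype.card_fin, Nat.cast_ofNat] at h
  calc Torus.euclidDist y z
      = Torus.euclidDist (Torus.proj (Torus.repr y)) (Torus.proj (Torus.repr z)) := by
        rw [Torus.proj_repr, Torus.proj_repr]
    _ ≤ ‖Torus.repr y - Torus.repr z‖ := Torus.euclidDist_proj_le_norm_sub_holds _ _
    _ ≤ Real.sqrt 3 / k := h

/-- **The cells whose marked point is `ℓ`-close to `x` are at most `k³ · vol B(x, ℓ + 2/k)` in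
number.** If `c j ∈ cell j` for every `j : Fin 3 → Fin k` and `ℓ + 2/k < 1/2`, then
`#{j : d_𝕋³(c j, x) < ℓ} ≤ k³ · (4/3)π(ℓ + 2/k)³`: each such cell lies inside the minimal-image ball
`B(x, ℓ + 2/k)` (cells have diameter `≤ √3/k < 2/k`), the cells are pairwise disjoint of Haar
volume `k⁻³`, and the ball is Euclidean. Registered stub `cells_meeting_ball_card_le` of the line
`small-tilt-domination`. [folklore] -/
theorem cells_meeting_ball_card_le : ∀ {k : ℕ}, 0 < k → ∀ {ℓ : ℝ}, 0 < ℓ → ℓ + 2 / k < 1 / 2 → ∀ (x : T3) (c : (Fin 3 → Fin k) → T3), (∀ j, Torus.gridIndex k (Torus.repr (c j)) = Torus.finIndex j) → ((Finset.univ.filter fun j => Torus.euclidDist (c j) x < ℓ).card : ℝ) ≤ (k : ℝ) ^ 3 * (4 / 3 * Real.pi * (ℓ + 2 / k) ^ 3) := by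
  intro k hk ℓ hℓ hhalf x c hc
  set A := Finset.univ.filter fun j => Torus.euclidDist (c j) x < ℓ
  have hk' : (0 : ℝ) < k := by exact_mod_cast hk
  have hr0 : 0 < ℓ + 2 / k := by positivity
  -- the diameter of a cell is `≤ √3/k < 2/k`
  have hsqrt : Real.sqrt 3 / k < 2 / k := by
    refine div_lt_div_of_pos_right ?_ hk'
    rw [Real.sqrt_lt' two_pos]
    norm_num
  -- every cell whose marked point is `ℓ`-close to `x` lies inside the ball `B(x, ℓ + 2/k)`
  have hsub : ∀ j ∈ A, {y : T3 | Torus.gridIndex k (Torus.repr y) = Torus.finIndex j} ⊆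
      {y | Torus.euclidDist y x < ℓ + 2 / k} := by
    intro j hj y hy
    have hj' : Torus.euclidDist (c j) x < ℓ := (Finset.mem_filter.1 hj).2
    have hyc : Torus.euclidDist y (c j) ≤ Real.sqrt 3 / k := cmb_euclidDist_le_of_cell hk hy (hc j)
    have htri := euclidDist_triangle y (c j) x
    show Torus.euclidDist y x < ℓ + 2 / k
    linarith
  -- the cells are pairwise disjoint and measurable: compare Haar volumes
  have hdisj : Set.PairwiseDisjoint (↑A : Set (Fin 3 → Fin k))
      fun j => {y : T3 | Torus.gridIndex k (Torus.repr y) = Torus.finIndex j} :=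
    (pairwise_disjoint_cell (k := k)).set_pairwise _
  have hvol : ∑ j ∈ A, volume {y : T3 | Torus.gridIndex k (Torus.repr y) = Torus.finIndex j} ≤
      volume {y | Torus.euclidDist y x < ℓ + 2 / k} := by
    rw [← measure_biUnion_finset hdisj fun j _ => measurableSet_cell hk j]
    exact measure_mono (Set.iUnion₂_subset hsub)
  rw [Finset.sum_congr rfl fun j _ => volume_cell hk j, Finset.sum_const, nsmul_eq_mul,
    volume_setOf_euclidDist_lt_T3 hr0.le hhalf x] at hvol
  -- back to real numbers
  have hV : 0 ≤ 4 / 3 * Real.pi * (ℓ + 2 / k) ^ 3 := by positivity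
  have h2 := ENNReal.toReal_le_of_le_ofReal hV hvol
  rw [ENNReal.toReal_mul, ENNReal.toReal_pow, ENNReal.toReal_inv, ENNReal.toReal_natCast,
    ENNReal.toReal_natCast] at h2
  have hk3 : (0 : ℝ) < (k : ℝ) ^ 3 := by positivity
  calc (A.card : ℝ) = (A.card : ℝ) * ((k : ℝ)⁻¹) ^ 3 * (k : ℝ) ^ 3 := by
        rw [inv_pow, mul_assoc, inv_mul_cancel₀ hk3.ne', mul_one]
    _ ≤ 4 / 3 * Real.pi * (ℓ + 2 / k) ^ 3 * (k : ℝ) ^ 3 := mul_le_mul_of_nonneg_right h2 hk3.le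
    _ = (k : ℝ) ^ 3 * (4 / 3 * Real.pi * (ℓ + 2 / k) ^ 3) := mul_comm _ _

end Summit.AtomisticToContinuum.HydrodynamicLimit.Theorems.NearConstantShortTimeHL

end
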